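import Mathlib

/-!
# Bounded degree of solvability of a polynomial system over the points of a Noetherian ring

Topic: `Literature/RingTheory/MvPolynomial`. Let `A` be a Noetherian ring and `S = (S_j)_j` a
family of polynomials in finitely many variables over `A`. Suppose that at every field-valued
point `φ : A → L` with `L` algebraically closed the specialised system `S^φ` has a zero in `L`.
**Then there is an integer `B` such that at every field-valued point `φ : A → K` the system `S^φ`
has a zero in a field extension `E ⊇ K` of degree `[E : K] ≤ B`**
(`exists_finrank_bound_of_forall_exists_zero`).

This is the standard "spreading out / constructibility" argument (EGA IV₃ §9, generic behaviour in
families), organised as a Noetherian induction on ideals of `A`: for a prime `𝔭`, a zero `ζ` over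
the algebraic closure of `K₀ = Frac(A/𝔭)` generates a finite extension `E₀ = K₀(ζ)` with a
`K₀`-basis `f` containing `1`; after clearing a common denominator `a ∉ 𝔭` of the structure
constants of `f` and of the coordinates of `ζ`, the `A/𝔭`-span `R₀` of `1, a f_i` is a free
`A/𝔭`-subalgebra of `E₀` containing `a² ζ`; for a point `φ` through `𝔭` with `φ(a) ≠ 0` the base
change `K ⊗_{A/𝔭} R₀` is a non-zero `K`-algebra of dimension `[E₀ : K₀]`, and any residue field of
it is the required `E` (the zero is `φ(a)⁻² · (a² ζ)`); the points with `φ(a) = 0` pass through a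
minimal prime of `𝔭 + (a)`, and Noetherian induction concludes. It is used in
`Literature/RingTheory/MvPolynomial/LineChainsBoundedDegree` to bound the degree of the field of
definition of chains of lines on complete intersections (Kollár's integer `N` in
*Rational Curves on Algebraic Varieties* IV.3.13.3 / Tian–Zong 2014 Prop. 3.1, for lines).

## References

* A. Grothendieck, *EGA* IV₃, Publ. Math. IHÉS 28 (1966), §9.2–9.3 (constructibility in families).
-/

noncomputable section

open MvPolynomial Module

namespace Literature.RingTheory.MvPolynomial

universe u v w

/-! ## Rescaling a polynomial by powers of a scalar -/

section Rescale

variable {A : Type u} [CommRing A] {σ : Type v}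

/-- **Weighted rescaling.** For `P ∈ A[X_σ]` and `a ∈ A` there are `D` and `Q ∈ A[X_σ]` with
`Q^φ(φ(a) · x) = φ(a)^D · P^φ(x)` at every point `φ : A → R` and every `x ∈ R^σ`
(`Q = Σ_α P_α a^{D - |α|} X^α`, `D = deg P`). [folklore] -/
theorem exists_rescale (P : MvPolynomial σ A) (a : A) :
    ∃ (D : ℕ) (Q : MvPolynomial σ A), ∀ (R : Type u) [CommRing R] (φ : A →+* R) (x : σ → R),
      eval (φ a • x) (map φ Q) = φ a ^ D * eval x (map φ P) := by
  classical
  refine ⟨P.totalDegree, ∑ α ∈ P.support,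
    monomial α (coeff α P * a ^ (P.totalDegree - α.sum fun _ e => e)), fun R _ φ x => ?_⟩
  have hsum : eval x (map φ P) = ∑ α ∈ P.support, φ (coeff α P) * α.prod fun n e => x n ^ e := by
    conv_lhs => rw [P.as_sum]
    simp only [map_sum, map_monomial, eval_monomial]
  rw [hsum, Finset.mul_sum]
  simp only [map_sum, map_monomial, eval_monomial]
  refine Finset.sum_congr rfl fun α hα => ?_
  have hdeg : (α.sum fun _ e => e) ≤ P.totalDegree := le_totalDegree hα
  have hprod : (α.prod fun n e => (φ a • x) n ^ e) =
      φ a ^ (α.sum fun _ e => e) * α.prod fun n e => x n ^ e := by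
    simp only [Pi.smul_apply, smul_eq_mul, mul_pow]
    rw [Finsupp.prod_mul]
    congr 1
    exact Finset.prod_pow_eq_pow_sum _ _ _
  rw [hprod, map_mul, map_pow, ← pow_sub_mul_pow (φ a) hdeg]
  ring

end Rescale

/-! ## Transport of equations along ring homomorphisms -/

section Transport

variable {A : Type u} [CommRing A] {σ : Type v}

/-- `ψ (P^ρ(x)) = P^{ψ ∘ ρ}(ψ ∘ x)`. [folklore] -/
theorem apply_eval_map {T E : Type*} [CommRing T] [CommRing E] (ψ : T →+* E) (ρ : A →+* T)
    (x : σ → T) (P : MvPolynomial σ A) :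
    ψ (eval x (map ρ P)) = eval (ψ ∘ x) (map (ψ.comp ρ) P) := by
  rw [eval_map, eval_map, eval₂_comp_left]

end Transport

/-! ## Residue fields of a free algebra after base change to a field -/

section BaseChange

/-- **A non-zero finite free algebra acquires, after base change to a field `K`, a residue field of
degree at most its rank.** For a commutative `R`-algebra `T` free of finite positive rank `n` as an
`R`-module and a field `K` with `R → K`, some quotient of `K ⊗_R T` is a field `E` with
`0 < [E : K] ≤ n`, receiving `T` compatibly with `R → K → E`. [folklore] -/
theorem exists_field_of_basis {R : Type u} [CommRing R] {T : Type u} [CommRing T] [Algebra R T]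
    {ι : Type*} [Fintype ι] [Nonempty ι] (b : Basis ι R T) (K : Type u) [Field K] [Algebra R K] :
    ∃ (E : Type u) (_ : Field E) (_ : Algebra K E) (ψ : T →+* E),
      finrank K E ≤ Fintype.card ι ∧ 0 < finrank K E ∧
        ∀ r : R, ψ (algebraMap R T r) = algebraMap K E (algebraMap R K r) := by
  classical
  let Tn := TensorProduct R K T
  let bK : Basis ι K Tn := Algebra.TensorProduct.basis K b
  have hrank : finrank K Tn = Fintype.card ι := finrank_eq_card_basis bK
  haveI : Nontrivial Tn := nontrivial_of_finrank_pos (R := K) (by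
    rw [hrank]; exact Fintype.card_pos)
  haveI : Module.Finite K Tn := Module.Finite.of_basis bK
  obtain ⟨𝔪, h𝔪⟩ := Ideal.exists_maximal Tn
  haveI := h𝔪
  let E := Tn ⧸ 𝔪
  letI : Field E := Ideal.Quotient.field 𝔪
  have hsurj : Function.Surjective (Ideal.Quotient.mkₐ K 𝔪 : Tn →ₐ[K] E) :=
    Ideal.Quotient.mkₐ_surjective K 𝔪
  haveI : Module.Finite K E := Module.Finite.of_surjective (Ideal.Quotient.mkₐ K 𝔪).toLinearMap hsurj
  refine ⟨E, inferInstance, inferInstance,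
    (Ideal.Quotient.mk 𝔪).comp (Algebra.TensorProduct.includeRight (R := R) (A := K) (B := T)).toRingHom,
    ?_, finrank_pos, fun r => ?_⟩
  · rw [← hrank]
    exact LinearMap.finrank_le_finrank_of_surjective
      (f := (Ideal.Quotient.mkₐ K 𝔪).toLinearMap) hsurj
  · change Ideal.Quotient.mk 𝔪 (Algebra.TensorProduct.includeRight (algebraMap R T r)) =
      Ideal.Quotient.mk 𝔪 (algebraMap K Tn (algebraMap R K r))
    rw [AlgHom.commutes, Algebra.TensorProduct.algebraMap_apply,
      Algebra.TensorProduct.algebraMap_apply, Algebra.algebraMap_self, RingHom.id_apply]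

end BaseChange

/-! ## A free subalgebra spanned by a multiplicatively closed independent family -/

section SpanSubalgebra

variable {R : Type u} [CommRing R] {L : Type u} [CommRing L] [Algebra R L]

/-- **The span of an `R`-independent family `g` containing `1` and closed under products is a free
`R`-subalgebra with basis `g`.** [folklore] -/
theorem exists_subalgebra_basis_of_span {ι : Type*} (g : ι → L) (hg : LinearIndependent R g)
    (i₁ : ι) (hg1 : g i₁ = 1) (hmul : ∀ i j, g i * g j ∈ Submodule.span R (Set.range g)) :
    ∃ (T : Subalgebra R L) (b : Basis ι R T),
      (Subalgebra.toSubmodule T = Submodule.span R (Set.range g)) ∧ ∀ i, (b i : L) = g i := by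
  classical
  set M := Submodule.span R (Set.range g) with hM
  have hMM : M * M ≤ M := by
    rw [hM, Submodule.span_mul_span, Submodule.span_le]
    rintro _ ⟨_, ⟨i, rfl⟩, _, ⟨j, rfl⟩, rfl⟩
    exact hmul i j
  have h1 : (1 : L) ∈ M := hg1 ▸ Submodule.subset_span ⟨i₁, rfl⟩
  let T : Subalgebra R L :=
    { carrier := M
      mul_mem' := fun {x y} hx hy => hMM (Submodule.mul_mem_mul hx hy)
      one_mem' := h1
      add_mem' := fun {x y} hx hy => M.add_mem hx hy
      zero_mem' := M.zero_mem
      algebraMap_mem' := fun r => by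
        rw [Algebra.algebraMap_eq_smul_one]
        exact M.smul_mem r h1 }
  have hT : Subalgebra.toSubmodule T = M := SetLike.coe_injective rfl
  let b₀ : Basis ι R M := Basis.span hg
  let e : M ≃ₗ[R] Subalgebra.toSubmodule T := LinearEquiv.ofEq _ _ hT.symm
  refine ⟨T, b₀.map e, hT, fun i => ?_⟩
  change ((e (b₀ i) : Subalgebra.toSubmodule T) : L) = g i
  rw [LinearEquiv.coe_ofEq_apply, Basis.span_apply]

end SpanSubalgebra

/-! ## The generic step: spreading out a zero over the algebraic closure of `Frac(A/𝔭)` -/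

section Spread

variable {A : Type u} [CommRing A] (I : Ideal A) [I.IsPrime]
  (K₀ : Type u) [Field K₀] [Algebra (A ⧸ I) K₀] [IsFractionRing (A ⧸ I) K₀]
  (L₀ : Type u) [Field L₀] [Algebra K₀ L₀] [Algebra (A ⧸ I) L₀] [IsScalarTower (A ⧸ I) K₀ L₀]

/-- **Spreading out (core).** Let `𝔭 = I` be a prime of `A`, `K₀ = Frac(A/𝔭)`, `L₀` its algebraic
closure, `ζ ∈ L₀^σ` a zero of the system `S` at the point `A → L₀`, and `f` a `K₀`-independent
family in `L₀` containing `1`, whose `K₀`-span is closed under products and contains the `ζ_m`.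
Then there is `a ∉ 𝔭` such that at every field-valued point `φ` through `𝔭` with `φ(a) ≠ 0` the
system has a zero in an extension of degree at most `|f|`. [folklore] -/
theorem spread_core {σ : Type v} [Finite σ] {J : Type w} (S : J → MvPolynomial σ A)
    (ζ : σ → L₀)
    (hζ : ∀ j, eval ζ (map ((algebraMap (A ⧸ I) L₀).comp
      (Ideal.Quotient.mk I)) (S j)) = 0)
    {ι : Type u} [Fintype ι] (f : ι → L₀)
    (hf : LinearIndependent K₀ f) (i₁ : ι) (hf1 : f i₁ = 1)
    (hmul : ∀ i j, f i * f j ∈ Submodule.span K₀ (Set.range f))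
    (hζf : ∀ m, ζ m ∈ Submodule.span K₀ (Set.range f)) :
    ∃ a ∉ I, ∀ (K : Type u) [Field K] (φ : A →+* K), I ≤ RingHom.ker φ → φ a ≠ 0 →
      ∃ (E : Type u) (_ : Field E) (_ : Algebra K E),
        finrank K E ≤ Fintype.card ι ∧ 0 < finrank K E ∧
          ∃ x : σ → E, ∀ j, eval x (map ((algebraMap K E).comp φ) (S j)) = 0 := by
  classical
  have hinjK : Function.Injective (algebraMap (A ⧸ I) K₀) :=
    IsFractionRing.injective (A ⧸ I) K₀
  have hinjL : Function.Injective (algebraMap (A ⧸ I) L₀) := by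
    rw [IsScalarTower.algebraMap_eq (A ⧸ I) K₀ L₀]
    exact (algebraMap K₀ L₀).injective.comp hinjK
  -- coordinates of products and of `ζ` in the family `f`
  choose cM hcM using fun i j =>
    (Submodule.mem_span_range_iff_exists_fun (R := K₀)).mp (hmul i j)
  choose cZ hcZ using fun m => (Submodule.mem_span_range_iff_exists_fun (R := K₀)).mp (hζf m)
  -- a common denominator `ā = mk a ≠ 0`
  obtain ⟨d, hd⟩ := IsLocalization.exist_integer_multiples_of_finite (nonZeroDivisors (A ⧸ I))
    (Sum.elim (fun t : ι × ι × ι => cM t.1 t.2.1 t.2.2) (fun t : σ × ι => cZ t.1 t.2))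
  set ā : (A ⧸ I) := (d : (A ⧸ I)) with hā
  have hā0 : ā ≠ 0 := nonZeroDivisors.ne_zero d.2
  obtain ⟨a, ha⟩ := Ideal.Quotient.mk_surjective ā
  have haI : a ∉ I := fun h => hā0 (by rw [← ha]; exact Ideal.Quotient.eq_zero_iff_mem.mpr h)
  choose yM hyM using fun i j l => (hd (Sum.inl (i, j, l)))
  choose yZ hyZ using fun m l => (hd (Sum.inr (m, l)))
  -- `hyM i j l : algebraMap Ā K₀ (yM i j l) = ā • cM i j l`, similarly `hyZ`
  simp only [Sum.elim_inl, Sum.elim_inr] at hyM hyZ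
  set āL : L₀ := algebraMap (A ⧸ I) L₀ ā with hāL
  have hāL0 : āL ≠ 0 := fun h => hā0 (hinjL (by rw [← hāL, h, map_zero]))
  have hāLK : āL = algebraMap K₀ L₀ (algebraMap (A ⧸ I) K₀ ā) :=
    IsScalarTower.algebraMap_apply _ _ _ _
  -- the rescaled family `g`
  let g : ι → L₀ := fun i => if i = i₁ then 1 else āL * f i
  have hg1 : g i₁ = 1 := if_pos rfl
  have hgK : LinearIndependent K₀ g := by
    let w : ι → K₀ˣ := fun i => if i = i₁ then 1 else Units.mk0 (algebraMap (A ⧸ I) K₀ ā)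
      (fun h => hā0 (hinjK (by rw [h, map_zero])))
    have hgw : g = w • f := by
      funext i
      change g i = (w i : K₀) • f i
      by_cases hi : i = i₁
      · simp [g, w, hi, hf1]
      · simp only [g, w, if_neg hi, Units.val_mk0, Algebra.smul_def, hāLK]
    rw [hgw]
    exact hf.units_smul w
  have hgA : LinearIndependent (A ⧸ I) g :=
    hgK.restrict_scalars (fun r s h => hinjK (by
      simpa only [Algebra.smul_def, mul_one] using h))
  -- products of the `g i` lie in the `Ā`-span of `g`
  have hsmul : ∀ (y : (A ⧸ I)) (c : K₀), algebraMap (A ⧸ I) K₀ y = ā • c → ∀ v : L₀,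
      āL * (c • v) = y • v := by
    intro y c hyc v
    rw [Algebra.smul_def, hāLK, ← mul_assoc, ← map_mul, ← Algebra.smul_def ā c, ← hyc,
      ← IsScalarTower.algebraMap_apply, ← Algebra.smul_def]
  have hgg : ∀ i j, g i * g j ∈ Submodule.span (A ⧸ I) (Set.range g) := by
    intro i j
    by_cases hi : i = i₁
    · simp only [g, if_pos hi, one_mul]
      exact Submodule.subset_span ⟨j, rfl⟩
    by_cases hj : j = i₁
    · simp only [g, if_pos hj, mul_one]
      exact Submodule.subset_span ⟨i, rfl⟩
    have hprod : g i * g j = ∑ l, āL * ((yM i j l) • f l) := by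
      simp only [g, if_neg hi, if_neg hj]
      rw [show āL * f i * (āL * f j) = āL * (āL * (f i * f j)) by ring, ← hcM i j,
        Finset.mul_sum, Finset.mul_sum]
      refine Finset.sum_congr rfl fun l _ => ?_
      rw [hsmul (yM i j l) (cM i j l) (hyM i j l)]
    rw [hprod]
    refine Submodule.sum_mem _ fun l _ => ?_
    by_cases hl : l = i₁
    · subst hl
      rw [hf1, show āL * (yM i j l • (1 : L₀)) = (yM i j l * ā) • g l by
        rw [hg1, mul_smul, Algebra.smul_def ā (1 : L₀), mul_one, ← hāL, Algebra.smul_def,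
          Algebra.smul_def, mul_one, mul_comm]]
      exact Submodule.smul_mem _ _ (Submodule.subset_span ⟨l, rfl⟩)
    · rw [show āL * (yM i j l • f l) = yM i j l • g l by
        simp only [g, if_neg hl]; rw [Algebra.smul_def, Algebra.smul_def, mul_left_comm]]
      exact Submodule.smul_mem _ _ (Submodule.subset_span ⟨l, rfl⟩)
  -- the free subalgebra `T = span_Ā g` and `ā² ζ ∈ T`
  obtain ⟨T, bT, hT, hbT⟩ := exists_subalgebra_basis_of_span g hgA i₁ hg1 hgg
  have hmemT : ∀ v : L₀, v ∈ T ↔ v ∈ Submodule.span (A ⧸ I) (Set.range g) := fun v => by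
    rw [← Subalgebra.mem_toSubmodule, hT]
  have hζT : ∀ m, āL ^ 2 * ζ m ∈ T := by
    intro m
    rw [hmemT, ← hcZ m, Finset.mul_sum]
    refine Submodule.sum_mem _ fun l _ => ?_
    rw [pow_two, mul_assoc, hsmul (yZ m l) (cZ m l) (hyZ m l)]
    by_cases hl : l = i₁
    · subst hl
      rw [hf1, show āL * (yZ m l • (1 : L₀)) = (yZ m l * ā) • g l by
        rw [hg1, mul_smul, Algebra.smul_def ā (1 : L₀), mul_one, ← hāL, Algebra.smul_def,
          Algebra.smul_def, mul_one, mul_comm]]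
      exact Submodule.smul_mem _ _ (Submodule.subset_span ⟨l, rfl⟩)
    · rw [show āL * (yZ m l • f l) = yZ m l • g l by
        simp only [g, if_neg hl]; rw [Algebra.smul_def, Algebra.smul_def, mul_left_comm]]
      exact Submodule.smul_mem _ _ (Submodule.subset_span ⟨l, rfl⟩)
  -- the zero `ā² ζ` of the rescaled equations, inside `T`
  let wT : σ → T := fun m => ⟨āL ^ 2 * ζ m, hζT m⟩
  let ρ : A →+* T := (algebraMap (A ⧸ I) T).comp (Ideal.Quotient.mk I)
  have hρ : (T.val.toRingHom).comp ρ =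
      (algebraMap (A ⧸ I) L₀).comp (Ideal.Quotient.mk I) := by
    ext r; rfl
  choose D Q hQ using fun j => exists_rescale (S j) (a ^ 2)
  have hQT : ∀ j, eval wT (map ρ (Q j)) = 0 := by
    intro j
    apply Subtype.val_injective
    change T.val.toRingHom (eval wT (map ρ (Q j))) = 0
    rw [apply_eval_map, hρ]
    have hw : (T.val.toRingHom : T → L₀) ∘ wT =
        ((algebraMap (A ⧸ I) L₀).comp (Ideal.Quotient.mk I)) (a ^ 2) • ζ := by
      funext m
      simp only [Function.comp_apply, Pi.smul_apply, smul_eq_mul, RingHom.comp_apply, map_pow, ha]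
      rfl
    rw [hw, hQ j L₀, hζ j, mul_zero]
  -- conclusion
  haveI : Nonempty ι := ⟨i₁⟩
  refine ⟨a, haI, fun K _ φ hker hφa => ?_⟩
  let φbar : (A ⧸ I) →+* K := Ideal.Quotient.lift I φ fun r hr => hker hr
  letI : Algebra (A ⧸ I) K := φbar.toAlgebra
  obtain ⟨E, _, _, ψ, hle, hpos, hψ⟩ := exists_field_of_basis bT K
  refine ⟨E, inferInstance, inferInstance, hle, hpos, ?_⟩
  have hψρ : ψ.comp ρ = (algebraMap K E).comp φ := by
    ext r
    change ψ (algebraMap (A ⧸ I) T (Ideal.Quotient.mk I r)) = algebraMap K E (φ r)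
    rw [hψ]
    rfl
  set c : E := algebraMap K E (φ (a ^ 2)) with hc
  have hc0 : c ≠ 0 := by
    rw [hc, map_ne_zero, map_pow]; exact pow_ne_zero _ hφa
  refine ⟨fun m => c⁻¹ * ψ (wT m), fun j => ?_⟩
  have h1 : eval (ψ ∘ wT) (map ((algebraMap K E).comp φ) (Q j)) = 0 := by
    rw [← hψρ, ← apply_eval_map, hQT j, map_zero]
  have h2 := hQ j E ((algebraMap K E).comp φ) (fun m => c⁻¹ * ψ (wT m))
  have hcx : ((algebraMap K E).comp φ) (a ^ 2) • (fun m => c⁻¹ * ψ (wT m)) = ψ ∘ wT := by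
    funext m
    simp only [Pi.smul_apply, smul_eq_mul, RingHom.comp_apply, Function.comp_apply, ← hc]
    rw [← mul_assoc, mul_inv_cancel₀ hc0, one_mul]
  rw [hcx, h1] at h2
  have hcD : ((algebraMap K E).comp φ) (a ^ 2) ^ D j ≠ 0 := pow_ne_zero _ (by
    rw [RingHom.comp_apply, ← hc]; exact hc0)
  exact (mul_eq_zero.mp h2.symm).resolve_left hcD

/-- **Spreading out.** For a prime `𝔭 = I` of `A` at whose generic geometric point
`A → L₀ = (Frac(A/𝔭))^alg` the system `S` has a zero, there are `a ∉ 𝔭` and `B` such that at every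
field-valued point through `𝔭` with `φ(a) ≠ 0` the system has a zero in an extension of degree at
most `B` (`B = [K₀(ζ) : K₀]`). [folklore] -/
theorem spread_step [Algebra.IsAlgebraic K₀ L₀] {σ : Type v} [Finite σ] {J : Type w}
    (S : J → MvPolynomial σ A)
    (hS : ∃ ζ : σ → L₀,
      ∀ j, eval ζ (map ((algebraMap (A ⧸ I) L₀).comp (Ideal.Quotient.mk I)) (S j)) = 0) :
    ∃ a ∉ I, ∃ B : ℕ, ∀ (K : Type u) [Field K] (φ : A →+* K), I ≤ RingHom.ker φ → φ a ≠ 0 →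
      ∃ (E : Type u) (_ : Field E) (_ : Algebra K E),
        finrank K E ≤ B ∧ 0 < finrank K E ∧
          ∃ x : σ → E, ∀ j, eval x (map ((algebraMap K E).comp φ) (S j)) = 0 := by
  classical
  obtain ⟨ζ, hζ⟩ := hS
  -- the finite extension `E₀ = K₀(ζ)` and a basis containing `1`
  let E₀ : IntermediateField K₀ L₀ := IntermediateField.adjoin K₀ (Set.range ζ)
  haveI : Finite (Set.range ζ) := Set.finite_range ζ |>.to_subtype
  haveI hfd : FiniteDimensional K₀ E₀ :=
    IntermediateField.finiteDimensional_adjoin fun x _ =>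
      (Algebra.IsAlgebraic.isAlgebraic (R := K₀) x).isIntegral
  have hs : LinearIndepOn K₀ id ({1} : Set E₀) := LinearIndepOn.singleton (v := id) one_ne_zero
  let b := Module.Basis.extend hs
  haveI : Finite (hs.extend (Set.subset_univ _)) := Module.Finite.finite_basis b
  letI : Fintype (hs.extend (Set.subset_univ _)) := Fintype.ofFinite _
  let i₁ : hs.extend (Set.subset_univ _) :=
    ⟨1, Module.Basis.subset_extend hs (Set.mem_singleton 1)⟩
  have hb1 : b i₁ = 1 := Module.Basis.extend_apply_self hs i₁
  let f : hs.extend (Set.subset_univ _) → L₀ := fun i => (b i : L₀)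
  have hf : LinearIndependent K₀ f :=
    b.linearIndependent.map' (IntermediateField.val E₀).toLinearMap
      (LinearMap.ker_eq_bot.mpr (IntermediateField.val E₀).injective)
  have hE : ∀ y : E₀, (y : L₀) ∈ Submodule.span K₀ (Set.range f) := by
    intro y
    refine (Submodule.mem_span_range_iff_exists_fun (R := K₀)).mpr ⟨fun i => b.repr y i, ?_⟩
    conv_rhs => rw [← b.sum_repr y]
    rw [IntermediateField.coe_sum]
    exact Finset.sum_congr rfl fun i _ => (IntermediateField.coe_smul _ _ _).symm
  have hf1 : f i₁ = 1 := by
    change ((b i₁ : E₀) : L₀) = 1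
    rw [hb1]; rfl
  have hmul : ∀ i j, f i * f j ∈ Submodule.span K₀ (Set.range f) := fun i j => by
    have h := hE (b i * b j)
    rwa [IntermediateField.coe_mul] at h
  have hζf : ∀ m, ζ m ∈ Submodule.span K₀ (Set.range f) := fun m =>
    hE ⟨ζ m, IntermediateField.subset_adjoin K₀ _ ⟨m, rfl⟩⟩
  obtain ⟨a, haI, h⟩ := spread_core I K₀ L₀ S ζ hζ f hf i₁ hf1 hmul hζf
  exact ⟨a, haI, _, h⟩

end Spread

/-! ## The theorem -/

section Main

variable {A : Type u} [CommRing A] [IsNoetherianRing A] {σ : Type v} [Finite σ] {J : Type w}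

omit [Finite σ] in
/-- Bounds over the minimal primes of `I'` give a bound over all points through `I'`. [folklore] -/
theorem exists_bound_of_minimalPrimes (S : J → MvPolynomial σ A) (I' : Ideal A)
    (h : ∀ q ∈ I'.minimalPrimes, ∃ B : ℕ, ∀ (K : Type u) [Field K] (φ : A →+* K),
      q ≤ RingHom.ker φ → ∃ (E : Type u) (_ : Field E) (_ : Algebra K E),
        finrank K E ≤ B ∧ 0 < finrank K E ∧
          ∃ x : σ → E, ∀ j, eval x (map ((algebraMap K E).comp φ) (S j)) = 0) :
    ∃ B : ℕ, ∀ (K : Type u) [Field K] (φ : A →+* K),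
      I' ≤ RingHom.ker φ → ∃ (E : Type u) (_ : Field E) (_ : Algebra K E),
        finrank K E ≤ B ∧ 0 < finrank K E ∧
          ∃ x : σ → E, ∀ j, eval x (map ((algebraMap K E).comp φ) (S j)) = 0 := by
  classical
  have hfin := Ideal.finite_minimalPrimes_of_isNoetherianRing A I'
  choose! Bq hBq using h
  refine ⟨hfin.toFinset.sup Bq, fun K _ φ hle => ?_⟩
  haveI : (RingHom.ker φ).IsPrime := RingHom.ker_isPrime φ
  obtain ⟨q, hq, hqle⟩ := Ideal.exists_minimalPrimes_le hle
  obtain ⟨E, _, _, hB, hpos, hx⟩ := hBq q hq K φ hqle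
  exact ⟨E, inferInstance, inferInstance, hB.trans (Finset.le_sup (hfin.mem_toFinset.mpr hq)),
    hpos, hx⟩

/-- **Bounded degree of solvability in families.** Let `A` be a Noetherian ring and `S` a family of
polynomials in finitely many variables over `A` which has a zero at every algebraically closed
field-valued point `φ : A → L`. Then there is `B` such that at every field-valued point
`φ : A → K` the system has a zero in a field extension `E/K` with `0 < [E : K] ≤ B`. (Noetherian
induction on ideals: the generic step is `spread_step`; the points where its denominator vanishes
pass through the finitely many minimal primes of a larger ideal.) [folklore] -/
theorem exists_finrank_bound_of_forall_exists_zero (S : J → MvPolynomial σ A)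
    (hS : ∀ (L : Type u) [Field L] [IsAlgClosed L] (φ : A →+* L),
      ∃ x : σ → L, ∀ j, eval x (map φ (S j)) = 0) :
    ∃ B : ℕ, ∀ (K : Type u) [Field K] (φ : A →+* K),
      ∃ (E : Type u) (_ : Field E) (_ : Algebra K E),
        finrank K E ≤ B ∧ 0 < finrank K E ∧
          ∃ x : σ → E, ∀ j, eval x (map ((algebraMap K E).comp φ) (S j)) = 0 := by
  classical
  suffices key : ∀ I : Ideal A, ∃ B : ℕ, ∀ (K : Type u) [Field K] (φ : A →+* K),
      I ≤ RingHom.ker φ → ∃ (E : Type u) (_ : Field E) (_ : Algebra K E),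
        finrank K E ≤ B ∧ 0 < finrank K E ∧
          ∃ x : σ → E, ∀ j, eval x (map ((algebraMap K E).comp φ) (S j)) = 0 by
    obtain ⟨B, hB⟩ := key ⊥
    exact ⟨B, fun K _ φ => hB K φ bot_le⟩
  intro I
  refine IsNoetherian.induction (R := A) (M := A)
    (P := fun I : Ideal A => ∃ B : ℕ, ∀ (K : Type u) [Field K] (φ : A →+* K),
      I ≤ RingHom.ker φ → ∃ (E : Type u) (_ : Field E) (_ : Algebra K E),
        finrank K E ≤ B ∧ 0 < finrank K E ∧
          ∃ x : σ → E, ∀ j, eval x (map ((algebraMap K E).comp φ) (S j)) = 0)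
    (fun (I : Ideal A) IH => ?_) I
  by_cases hI : Ideal.IsPrime I
  · -- generic step at the prime `I`, recursion on `I + (a)`
    haveI := hI
    obtain ⟨ζ, hζ⟩ := hS (AlgebraicClosure (FractionRing (A ⧸ I)))
      ((algebraMap (A ⧸ I) _).comp (Ideal.Quotient.mk I))
    obtain ⟨a, haI, B₁, h₁⟩ := spread_step I (FractionRing (A ⧸ I))
      (AlgebraicClosure (FractionRing (A ⧸ I))) S ⟨ζ, hζ⟩
    have hgt : ∀ q ∈ (I ⊔ Ideal.span {a}).minimalPrimes, I < q := by
      intro q hq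
      have hle : I ⊔ Ideal.span {a} ≤ q := hq.1.2
      refine lt_of_le_of_ne (le_sup_left.trans hle) fun heq => haI ?_
      rw [heq]
      exact hle (Ideal.mem_sup_right (Ideal.subset_span rfl))
    obtain ⟨B₂, h₂⟩ := exists_bound_of_minimalPrimes S (I ⊔ Ideal.span {a})
      fun q hq => IH q (hgt q hq)
    refine ⟨max B₁ B₂, fun K _ φ hle => ?_⟩
    by_cases hφa : φ a = 0
    · have hle' : I ⊔ Ideal.span {a} ≤ RingHom.ker φ :=
        sup_le hle ((Ideal.span_singleton_le_iff_mem _).mpr hφa)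
      obtain ⟨E, _, _, hB, hpos, hx⟩ := h₂ K φ hle'
      exact ⟨E, inferInstance, inferInstance, hB.trans (le_max_right _ _), hpos, hx⟩
    · obtain ⟨E, _, _, hB, hpos, hx⟩ := h₁ K φ hle hφa
      exact ⟨E, inferInstance, inferInstance, hB.trans (le_max_left _ _), hpos, hx⟩
  · by_cases htop : I = ⊤
    · refine ⟨0, fun K _ φ hle => ?_⟩
      exact absurd (hle (htop ▸ Submodule.mem_top : (1 : A) ∈ I)) (by
        rw [RingHom.mem_ker, map_one]; exact one_ne_zero)
    · refine exists_bound_of_minimalPrimes S I fun q hq => IH q ?_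
      refine lt_of_le_of_ne hq.1.2 fun heq => hI ?_
      rw [heq]; exact hq.1.1

end Main





end Literature.RingTheory.MvPolynomial

end
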